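import Mathlib.LinearAlgebra.Transvection.Basic
import Mathlib.LinearAlgebra.Matrix.ToLin
import HarnessLib

/-!
# `GL_N` is transitive on the fibres `{x ⬝ᵥ y = b}` of the split hermitian form (dual-pair form)
# (Weil's hypothesis «`G′_v` opère transitivement sur `U(i)_v`» [Weil1965, n° 50 Thm 4] at a place SPLIT in `E/F`)

Topic `NumberTheory/Weil1965`; namespace `Literature.NumberTheory.Weil1965.SplitPlace`. KERNEL mathematics only (theorems;
no definition, no named fact, no `axiom`, no `sorry`).

At a finite place `v` of `F` split in the CM extension `E/F` the hermitian space `V ⊗_F F_v` is `K^ι × K^ι` (`K = F_v`) with the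
SPLIT FORM `h(x, y) = x ⬝ᵥ y`, and `U(V)(F_v) ≅ GL_ι(K)` acts through DUAL PAIRS `(g, g′)` of linear automorphisms with
`g u ⬝ᵥ g′ w = u ⬝ᵥ w` (`g′ = (gᵀ)⁻¹`; the currency of ★ `SplitPlaceFibreDensityScaling.fibreAvg_comp_dual`). Weil's uniqueness
theorem [Weil1965, Chap. V n° 50 Thm 4, p. 72] asks for a subgroup `G′_v ⊆ G_v` acting TRANSITIVELY on every fibre
`U(i)_v = {x ∈ X_v of maximal rank : h(x) = i}`; at rank one and a split place this is:

* **`exists_dualPair_apply_eq`** — for `x, y, x′, y′ : ι → K` all non-zero with `x ⬝ᵥ y = x′ ⬝ᵥ y′` there is a dual pair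
  `(g, g′)` with `g x = x′` and `g′ y = y′` — for EVERY value `b = x ⬝ᵥ y`, the cone `b = 0` included, and every finite `ι`
  (the «one orbit» input of ★-pending `MeasureTheory/Group/InvariantOrbitMeasureUniqueness`, row I-UNIQ of the E2-SW table).

The proof is two DILATRANSVECTIONS (Mathlib `LinearEquiv.dilatransvection`): the dual pair of `u ↦ u + (a ⬝ᵥ u) v` is
`(D_{a,v}, (D_{v,a})⁻¹)` (`dotProduct_dilatransvection_symm`); one moves `x ↦ x′` (`a ⬝ᵥ x = 1`, `v = x′ - x`, unit `a ⬝ᵥ x′`), the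
contragredient of a second moves `y₁ ↦ y′` while FIXING `x′` (because `x′ ⬝ᵥ (y′ - y₁) = 0`). No dimension count, no bases.

## References

* [Weil1965] A. Weil, *Sur la formule de Siegel dans la théorie des groupes classiques*, Acta Math. 113 (1965) 1–87: Chap. V n° 49
  Lemma 22 p. 70 (the hypothesis «`G′_v` opère transitivement sur `U(i)_v`»), n° 50 Thm 4 p. 72, Chap. VI n° 52 Thm 5 p. 76 (`G′_v = G_v`).
* [Artin1988] E. Artin, *Geometric Algebra* (1957; Wiley Classics reprint 1988), Ch. IV §1 (transvections; transitivity on vectors).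
-/

namespace Literature.NumberTheory.Weil1965.SplitPlace

variable {K : Type*} [Field K] {ι : Type*} [Fintype ι] [DecidableEq ι]

/-! ## §1 Dual vectors -/

/-- for `u ≠ 0` there is `a` with `a ⬝ᵥ u = 1` (a coordinate of `u` is invertible). [cite: Weil1965, Chap. V n° 49 Lemma 22, p. 70] -/
theorem exists_dotProduct_eq_one {u : ι → K} (hu : u ≠ 0) : ∃ a : ι → K, a ⬝ᵥ u = 1 := by
  obtain ⟨i, hi⟩ : ∃ i, u i ≠ 0 := by
    by_contra h
    push Not at h
    exact hu (funext h)
  refine ⟨Pi.single i (u i)⁻¹, ?_⟩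
  rw [single_dotProduct, inv_mul_cancel₀ hi]

/-- for `u, u′ ≠ 0` there is `a` with `a ⬝ᵥ u = 1` and `a ⬝ᵥ u′ ≠ 0` (if `a ⬝ᵥ u′ = 0`, correct `a` by an `a′` with `a′ ⬝ᵥ u′ = 1`).
[cite: Weil1965, Chap. V n° 49 Lemma 22, p. 70] -/
theorem exists_dotProduct_eq_one_ne_zero {u u' : ι → K} (hu : u ≠ 0) (hu' : u' ≠ 0) :
    ∃ a : ι → K, a ⬝ᵥ u = 1 ∧ a ⬝ᵥ u' ≠ 0 := by
  obtain ⟨a, ha⟩ := exists_dotProduct_eq_one hu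
  by_cases hau : a ⬝ᵥ u' = 0
  · obtain ⟨a', ha'⟩ := exists_dotProduct_eq_one hu'
    refine ⟨a + a' - (a' ⬝ᵥ u) • a, ?_, ?_⟩
    · rw [sub_dotProduct, add_dotProduct, smul_dotProduct, ha, smul_eq_mul, mul_one]; ring
    · rw [sub_dotProduct, add_dotProduct, smul_dotProduct, hau, ha', smul_eq_mul, mul_zero, zero_add, sub_zero]
      exact one_ne_zero
  · exact ⟨a, ha, hau⟩

/-! ## §2 The dual pair of a dilatransvection -/

omit [DecidableEq ι] in
/-- the unit condition is symmetric: `1 + a ⬝ᵥ v = 1 + v ⬝ᵥ a`. [cite: Weil1965, Chap. V n° 49 Lemma 22, p. 70] -/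
theorem isUnit_one_add_dotProduct_comm {a v : ι → K} (h : IsUnit (1 + dotProductBilin K K a v)) :
    IsUnit (1 + dotProductBilin K K v a) := by
  rw [dotProductBilin_apply_apply] at h ⊢
  rwa [dotProduct_comm]

omit [DecidableEq ι] in
/-- **the dual pair of a dilatransvection**: for `D_{a,v} u = u + (a ⬝ᵥ u) v` and `D_{v,a} w = w + (v ⬝ᵥ w) a`,
`D_{a,v} u ⬝ᵥ D_{v,a}⁻¹ w = u ⬝ᵥ w` — i.e. `(D_{a,v})ᵀ = D_{v,a}` for the dot product. [cite: Artin1988, Ch. IV §1] -/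
theorem dotProduct_dilatransvection_symm {a v : ι → K} (h : IsUnit (1 + dotProductBilin K K a v))
    (h' : IsUnit (1 + dotProductBilin K K v a)) (u w : ι → K) :
    LinearEquiv.dilatransvection h u ⬝ᵥ (LinearEquiv.dilatransvection h').symm w = u ⬝ᵥ w := by
  set w₀ := (LinearEquiv.dilatransvection h').symm w with hw₀
  have hw : w = LinearEquiv.dilatransvection h' w₀ := by rw [hw₀, LinearEquiv.apply_symm_apply]
  rw [hw, LinearEquiv.dilatransvection.apply, LinearEquiv.dilatransvection.apply, dotProductBilin_apply_apply,
    dotProductBilin_apply_apply, add_dotProduct, dotProduct_add, smul_dotProduct, dotProduct_smul, smul_eq_mul, smul_eq_mul,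
    dotProduct_comm v w₀, dotProduct_comm a u]
  ring

/-! ## §3 Moving the vector, then the covector -/

/-- **step A — `GL` is transitive on non-zero vectors, in dual-pair form**: for `x, x′ ≠ 0` a dual pair `(g, g′)` with `g x = x′`
(`g = D_{a, x′-x}` with `a ⬝ᵥ x = 1`, `a ⬝ᵥ x′ ≠ 0`). [cite: Artin1988, Ch. IV §1] [cite: Weil1965, Chap. V n° 49 Lemma 22, p. 70] -/
theorem exists_dualPair_apply_eq_left {x x' : ι → K} (hx : x ≠ 0) (hx' : x' ≠ 0) :
    ∃ g g' : (ι → K) ≃ₗ[K] (ι → K), (∀ u w, g u ⬝ᵥ g' w = u ⬝ᵥ w) ∧ g x = x' := by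
  obtain ⟨a, ha, ha'⟩ := exists_dotProduct_eq_one_ne_zero hx hx'
  have h : IsUnit (1 + dotProductBilin K K a (x' - x)) := by
    rw [dotProductBilin_apply_apply, dotProduct_sub, ha, add_sub_cancel, isUnit_iff_ne_zero]
    exact ha'
  refine ⟨LinearEquiv.dilatransvection h, (LinearEquiv.dilatransvection (isUnit_one_add_dotProduct_comm h)).symm,
    dotProduct_dilatransvection_symm h _, ?_⟩
  rw [LinearEquiv.dilatransvection.apply, dotProductBilin_apply_apply, ha, one_smul, add_sub_cancel]

/-- **step B — fixing the vector, move the covector**: for `y₁, y′ ≠ 0` with `x′ ⬝ᵥ y₁ = x′ ⬝ᵥ y′` a dual pair `(g, g′)` with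
`g x′ = x′` and `g′ y₁ = y′` (`g′ = D_{a, y′-y₁}` with `a ⬝ᵥ y₁ = 1`; its contragredient `g = (D_{y′-y₁, a})⁻¹` fixes `x′` BECAUSE
`(y′ - y₁) ⬝ᵥ x′ = 0`). [cite: Weil1965, Chap. V n° 49 Lemma 22, p. 70] [cite: Artin1988, Ch. IV §1] -/
theorem exists_dualPair_apply_eq_right {x' y₁ y' : ι → K} (hy₁ : y₁ ≠ 0) (hy' : y' ≠ 0) (hxy : x' ⬝ᵥ y₁ = x' ⬝ᵥ y') :
    ∃ g g' : (ι → K) ≃ₗ[K] (ι → K), (∀ u w, g u ⬝ᵥ g' w = u ⬝ᵥ w) ∧ g x' = x' ∧ g' y₁ = y' := by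
  obtain ⟨a, ha, ha'⟩ := exists_dotProduct_eq_one_ne_zero hy₁ hy'
  have h : IsUnit (1 + dotProductBilin K K a (y' - y₁)) := by
    rw [dotProductBilin_apply_apply, dotProduct_sub, ha, add_sub_cancel, isUnit_iff_ne_zero]
    exact ha'
  have h' : IsUnit (1 + dotProductBilin K K (y' - y₁) a) := isUnit_one_add_dotProduct_comm h
  refine ⟨(LinearEquiv.dilatransvection h').symm, LinearEquiv.dilatransvection h, fun u w => ?_, ?_, ?_⟩
  · rw [dotProduct_comm, dotProduct_dilatransvection_symm h h' w u, dotProduct_comm]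
  · rw [LinearEquiv.symm_apply_eq, LinearEquiv.dilatransvection.apply, dotProductBilin_apply_apply, sub_dotProduct,
      dotProduct_comm y' x', dotProduct_comm y₁ x', hxy, sub_self, zero_smul, add_zero]
  · rw [LinearEquiv.dilatransvection.apply, dotProductBilin_apply_apply, ha, one_smul, add_sub_cancel]

/-! ## §4 Transitivity on every fibre -/

/-- **`GL_ι(K)` IS TRANSITIVE ON EVERY FIBRE `{(x, y) : x ⬝ᵥ y = b, x ≠ 0, y ≠ 0}` OF THE SPLIT FORM, in dual-pair form**: for
`x, y, x′, y′` all non-zero with `x ⬝ᵥ y = x′ ⬝ᵥ y′` there are linear automorphisms `g, g′` of `K^ι` with `g u ⬝ᵥ g′ w = u ⬝ᵥ w` for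
all `u, w`, `g x = x′` and `g′ y = y′` — Weil's hypothesis «`G′_v` opère transitivement sur `U(i)_v` quel que soit `i`» at a place split
in `E/F` (`U(V)(F_v) ≅ GL_N(F_v)` acting on `V_v = F_vᴺ × F_vᴺ` by `(g, (gᵀ)⁻¹)`), for every `i` including the cone `i = 0`, with
`G′_v = G_v`. [cite: Weil1965, Chap. V n° 50 Thm 4, p. 72] [cite: Weil1965, Chap. VI n° 52 Thm 5, p. 76] -/
theorem exists_dualPair_apply_eq {x y x' y' : ι → K} (hx : x ≠ 0) (hy : y ≠ 0) (hx' : x' ≠ 0) (hy' : y' ≠ 0)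
    (hb : x ⬝ᵥ y = x' ⬝ᵥ y') :
    ∃ g g' : (ι → K) ≃ₗ[K] (ι → K), (∀ u w, g u ⬝ᵥ g' w = u ⬝ᵥ w) ∧ g x = x' ∧ g' y = y' := by
  obtain ⟨g₁, g₁', hd₁, hgx⟩ := exists_dualPair_apply_eq_left hx hx'
  have hy₁ : g₁' y ≠ 0 := fun h => hy (g₁'.map_eq_zero_iff.1 h)
  have hxy : x' ⬝ᵥ g₁' y = x' ⬝ᵥ y' := by rw [← hgx, hd₁, hb, hgx]
  obtain ⟨g₂, g₂', hd₂, hgx', hgy⟩ := exists_dualPair_apply_eq_right hy₁ hy' hxy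
  refine ⟨g₁.trans g₂, g₁'.trans g₂', fun u w => ?_, ?_, ?_⟩
  · rw [LinearEquiv.trans_apply, LinearEquiv.trans_apply, hd₂, hd₁]
  · rw [LinearEquiv.trans_apply, hgx, hgx']
  · rw [LinearEquiv.trans_apply, hgy]

/-- the same with the fibre spelled out as a set: any two points of `U(b) = {(x, y) : x ⬝ᵥ y = b, x ≠ 0, y ≠ 0}` are related by a
dual pair. [cite: Weil1965, Chap. V n° 50 Thm 4, p. 72] -/
theorem exists_dualPair_apply_eq_of_mem {b : K} {z z' : (ι → K) × (ι → K)}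
    (hz : z ∈ {p : (ι → K) × (ι → K) | p.1 ⬝ᵥ p.2 = b ∧ p.1 ≠ 0 ∧ p.2 ≠ 0})
    (hz' : z' ∈ {p : (ι → K) × (ι → K) | p.1 ⬝ᵥ p.2 = b ∧ p.1 ≠ 0 ∧ p.2 ≠ 0}) :
    ∃ g g' : (ι → K) ≃ₗ[K] (ι → K), (∀ u w, g u ⬝ᵥ g' w = u ⬝ᵥ w) ∧ (g z.1, g' z.2) = z' := by
  obtain ⟨hb, h1, h2⟩ := hz
  obtain ⟨hb', h1', h2'⟩ := hz'
  obtain ⟨g, g', hd, hgx, hgy⟩ := exists_dualPair_apply_eq h1 h2 h1' h2' (hb.trans hb'.symm)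
  exact ⟨g, g', hd, Prod.ext hgx hgy⟩

omit [DecidableEq ι] in
/-- conversely a dual pair PRESERVES every fibre: `g x ⬝ᵥ g′ y = x ⬝ᵥ y`, `g x ≠ 0`, `g′ y ≠ 0`. [cite: Weil1965, Chap. V n° 50 Thm 4, p. 72] -/
theorem dualPair_mem_fibre {b : K} (g g' : (ι → K) ≃ₗ[K] (ι → K)) (hd : ∀ u w, g u ⬝ᵥ g' w = u ⬝ᵥ w)
    {z : (ι → K) × (ι → K)} (hz : z ∈ {p : (ι → K) × (ι → K) | p.1 ⬝ᵥ p.2 = b ∧ p.1 ≠ 0 ∧ p.2 ≠ 0}) :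
    (g z.1, g' z.2) ∈ {p : (ι → K) × (ι → K) | p.1 ⬝ᵥ p.2 = b ∧ p.1 ≠ 0 ∧ p.2 ≠ 0} := by
  obtain ⟨hb, h1, h2⟩ := hz
  exact ⟨(hd z.1 z.2).trans hb, fun h => h1 (g.map_eq_zero_iff.1 h), fun h => h2 (g'.map_eq_zero_iff.1 h)⟩

end Literature.NumberTheory.Weil1965.SplitPlace
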